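import Mathlib
import Summits.NavierStokesRegularity.NavierStokesRegularity.Theorems.PicardRadiiRungThreeRadiiGlueRCore
import HarnessLib

/-!
# `PicardRadiiRungThree.RadiiGlueR` (item stmt-NavierStokesRegularity-23947) — the Newton–Kantorovich
  clause of the certificate: zeros and their Lipschitz dependence on the base point

Route `PicardRadiiRungThree` (rung TL-M3 of the Tao ladder; MODEL lattice ODEs only). The certificate
`PicardRadiiCertificateR` records per (stage, restart) the Newton–Kantorovich data
`NK = (A injective, ‖A G(x̄)‖ ≤ Y₀, ‖A‖ ≤ Λ(1−Z), on the r₂-ball: G differentiable with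
‖I − A∘G'‖ ≤ Z)` together with `r₁ ≤ r₂`, `Z < 1`, `Y₀ + Z r₁ ≤ r₁`. This file turns that clause into
what the extraction glue consumes, for maps between real Banach/normed spaces:

* `exists_zero_of_nk` — a zero `x⋆` of `G` with `‖x⋆ − x̄‖ ≤ r₁` (the tree's
  `existsUnique_zero_of_newtonLike_twoRadii_of_le`; `0 ≤ r₁` follows from `Y₀ ≥ 0`, `Z < 1`);
* `norm_sub_le_of_nk_shift` — if `G₂ = G₁ + v` (constant shift), `x₁, x₂` are the zeros of `G₁, G₂`
  within `r₁` of their base points and the base points are coherent (`‖x̄₁ − x̄₂‖ + r₁ ≤ r₂`), then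
  `‖x₁ − x₂‖ ≤ Λ ‖v‖` (the TUBE Lipschitz constant of the window certificate).

HONEST FRAMING: elementary functional analysis; nothing here is a statement about the Navier–Stokes
equations; NS regularity is NOT proved by anything in this file.
-/

noncomputable section

-- the sub-problem namespace repeats the summit name by design (D-0017)
set_option linter.dupNamespace false

namespace Summit.NavierStokesRegularity.NavierStokesRegularity.Theorems

open Set Metric Function Literature.Analysis.Calculus

namespace RadiiGlueR

variable {X Y : Type*} [NormedAddCommGroup X] [NormedSpace ℝ X]
  [NormedAddCommGroup Y] [NormedSpace ℝ Y]

/-- The existence radius of a Newton–Kantorovich certificate is nonnegative: `‖A G(x̄)‖ ≤ Y₀`, `Z < 1`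
and `Y₀ + Z r₁ ≤ r₁` force `0 ≤ r₁`. [folklore] -/
theorem nk_radius_nonneg {a Y₀ Z r₁ : ℝ} (ha : 0 ≤ a) (hY : a ≤ Y₀) (hZ1 : Z < 1)
    (hp : Y₀ + Z * r₁ ≤ r₁) : 0 ≤ r₁ := by
  nlinarith

/-- **Zero of a Newton–Kantorovich certificate.** `X` real Banach, `Y` real normed, `A : Y →L X`
injective, `‖A (G x̄)‖ ≤ Y₀`, on the closed `r₂`-ball around `x̄` the map `G` has derivative `G'(x)`
with `‖I − A ∘ G'(x)‖ ≤ Z`, and `r₁ ≤ r₂`, `Z < 1`, `Y₀ + Z r₁ ≤ r₁`. Then `G` has a zero `x⋆` with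
`‖x⋆ − x̄‖ ≤ r₁`. [cite: ConstantineauGarciaAzpeitiaLessard2021, Thm. 3.1 (arXiv p. 8), non-strict variant] -/
theorem exists_zero_of_nk [CompleteSpace X] {G : X → Y} {G' : X → X →L[ℝ] Y} {xbar : X}
    {A : Y →L[ℝ] X} {Y₀ Z r₁ r₂ : ℝ} (hA : Injective A) (hY : ‖A (G xbar)‖ ≤ Y₀)
    (hball : ∀ x, ‖x - xbar‖ ≤ r₂ →
      HasFDerivAt G (G' x) x ∧ ‖ContinuousLinearMap.id ℝ X - A.comp (G' x)‖ ≤ Z)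
    (hr : r₁ ≤ r₂) (hZ1 : Z < 1) (hp : Y₀ + Z * r₁ ≤ r₁) :
    ∃ x : X, G x = 0 ∧ ‖x - xbar‖ ≤ r₁ := by
  have hr₁ : 0 ≤ r₁ := nk_radius_nonneg (norm_nonneg _) hY hZ1 hp
  have hF : ∀ x ∈ closedBall xbar r₂, HasFDerivAt G (G' x) x := fun x hx =>
    (hball x (mem_closedBall_iff_norm.mp hx)).1
  have hZ : ∀ x ∈ closedBall xbar r₂, ‖ContinuousLinearMap.id ℝ X - A.comp (G' x)‖ ≤ Z := fun x hx =>
    (hball x (mem_closedBall_iff_norm.mp hx)).2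
  obtain ⟨x, hx, hGx, -, -⟩ :=
    existsUnique_zero_of_newtonLike_twoRadii_of_le hr₁ hr hA hF hY hZ hZ1 hp
  exact ⟨x, hGx, mem_closedBall_iff_norm.mp hx⟩

/-- **Lipschitz dependence of the certified zero on a constant shift of the map.** Let `G₂ = G₁ + v`
(constant `v ∈ Y`), let `G₁` have derivative `G'(x)` with `‖I − A ∘ G'(x)‖ ≤ Z` on the closed `r₂`-ball
around `x̄₁`, `Z < 1`, `‖A‖ ≤ Λ (1 − Z)`, and let `x₁`, `x₂` be zeros of `G₁`, `G₂` with
`‖x₁ − x̄₁‖ ≤ r₁`, `‖x₂ − x̄₂‖ ≤ r₁` for base points with `‖x̄₁ − x̄₂‖ + r₁ ≤ r₂`. Then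
`‖x₁ − x₂‖ ≤ Λ ‖v‖`. [cite: ConstantineauGarciaAzpeitiaLessard2021, Thm. 3.1 (arXiv p. 8), contraction step of the proof] -/
theorem norm_sub_le_of_nk_shift {G₁ G₂ : X → Y} {G' : X → X →L[ℝ] Y} {xbar₁ xbar₂ : X}
    {A : Y →L[ℝ] X} {Z Λ r₁ r₂ : ℝ} {v : Y} {x₁ x₂ : X}
    (hG₂ : ∀ x, G₂ x = G₁ x + v)
    (hball : ∀ x, ‖x - xbar₁‖ ≤ r₂ →
      HasFDerivAt G₁ (G' x) x ∧ ‖ContinuousLinearMap.id ℝ X - A.comp (G' x)‖ ≤ Z)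
    (hZ1 : Z < 1) (hAΛ : ‖A‖ ≤ Λ * (1 - Z))
    (h₁ : G₁ x₁ = 0) (h₂ : G₂ x₂ = 0) (hx₁ : ‖x₁ - xbar₁‖ ≤ r₁) (hx₂ : ‖x₂ - xbar₂‖ ≤ r₁)
    (hcoh : ‖xbar₁ - xbar₂‖ + r₁ ≤ r₂) :
    ‖x₁ - x₂‖ ≤ Λ * ‖v‖ := by
  have hF : ∀ x ∈ closedBall xbar₁ r₂, HasFDerivAt G₁ (G' x) x := fun x hx =>
    (hball x (mem_closedBall_iff_norm.mp hx)).1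
  have hZ : ∀ x ∈ closedBall xbar₁ r₂, ‖ContinuousLinearMap.id ℝ X - A.comp (G' x)‖ ≤ Z := fun x hx =>
    (hball x (mem_closedBall_iff_norm.mp hx)).2
  have hr₁₂ : r₁ ≤ r₂ := by linarith [norm_nonneg (xbar₁ - xbar₂)]
  have hx₁' : x₁ ∈ closedBall xbar₁ r₂ := mem_closedBall_iff_norm.mpr (hx₁.trans hr₁₂)
  have hx₂' : x₂ ∈ closedBall xbar₁ r₂ := by
    rw [mem_closedBall_iff_norm]
    calc ‖x₂ - xbar₁‖ = ‖(x₂ - xbar₂) + (xbar₂ - xbar₁)‖ := by abel_nf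
      _ ≤ ‖x₂ - xbar₂‖ + ‖xbar₂ - xbar₁‖ := norm_add_le _ _
      _ ≤ r₁ + ‖xbar₁ - xbar₂‖ := by rw [norm_sub_rev xbar₂ xbar₁]; linarith
      _ ≤ r₂ := by linarith
  have h₂' : G₁ x₂ + v = 0 := by rw [← hG₂]; exact h₂
  have hkey := norm_sub_le_of_zero_of_zero_add_const hF hZ hZ1 hx₁' hx₂' h₁ h₂'
  have h1Z : 0 < 1 - Z := by linarith
  have hAv : ‖A v‖ ≤ Λ * (1 - Z) * ‖v‖ := (A.le_opNorm v).trans (mul_le_mul_of_nonneg_right hAΛ (norm_nonneg _))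
  calc ‖x₁ - x₂‖ ≤ ‖A v‖ / (1 - Z) := hkey
    _ ≤ Λ * (1 - Z) * ‖v‖ / (1 - Z) := div_le_div_of_nonneg_right hAv h1Z.le
    _ = Λ * ‖v‖ := by field_simp

end RadiiGlueR

end Summit.NavierStokesRegularity.NavierStokesRegularity.Theorems

end
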